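import Literature.Probability.Percolation.CornerPercolation
import HarnessLib

/-!
# Stub `stub_upper` (crux stmt-CriticalPhenomena-5476 `UniformBoxCrossing`, line `Sketch`):
# lower bounds at every bounded aspect ratio ⇒ upper bounds, uniformly in `t`, by self-duality

The duality step of the box-crossing engine for the corner percolation models
`M_t = cornerPercolation t` on `ℤ²`, `t ∈ [0, 1]` (Bollobás–Riordan, *Percolation* (2006), Ch. 3,
Cor. 3(i), there for bond percolation at `p = 1/2`). For `M_t` the planar dual is the point
reflection of `M_t`, which the tree records as the exact identity
`cornerPercolation_real_lrCrossing_add : M_t(LR([0, m + 1] × [0, n])) + M_t(LR([0, n + 1] × [0, m])) = 1`.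

* `stub_upper` — the registered stub: if for every `k` there are `c > 0`, `n₀` with
  `c ≤ M_t(LR([0, M] × [0, N]))` whenever `N ≥ n₀`, `M ≤ k N` (uniformly in `t`), then for every `k`
  there are `c > 0`, `n₀` with `M_t(LR([0, M] × [0, N])) ≤ 1 - c` whenever `M ≥ n₀`, `N ≤ k M`.
  Proof: apply the hypothesis at aspect ratio `k + 2`; for `M = m + 1 ≥ n₀ + k + 2` and `N ≤ k M`
  one has `m ≥ n₀` and `N + 1 ≤ (k + 2) m`, so `c ≤ M_t(LR(N + 1, m)) = 1 - M_t(LR(m + 1, N))`.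
-/

noncomputable section

namespace Summit.CriticalPhenomena.CardyFormulaZ2.Cruxes.UniformBoxCrossing.NonSlantLine

open MeasureTheory Literature.Probability.Percolation Literature.Probability.LatticeModels

/-- **Stub 5 (upper bounds by self-duality).** Uniform lower bounds at every bounded aspect ratio
give uniform upper bounds at every bounded inverse aspect ratio:
`M_t(LR([0,m+1] × [0,n])) = 1 - M_t(LR([0,n+1] × [0,m]))` (`cornerPercolation_real_lrCrossing_add`,
the planar dual of `M_t` is its point reflection). (Bollobás–Riordan 2006, Ch. 3, Cor. 3(i), for
`P_{1/2}`.) [folklore] -/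
theorem stub_upper
    (hLB : ∀ k : ℕ, ∃ c : ℝ, 0 < c ∧ ∃ n₀ : ℕ, ∀ (t : unitInterval) (M N : ℕ), n₀ ≤ N →
      M ≤ k * N → c ≤ (cornerPercolation t).real (lrCrossing M N)) :
    ∀ k : ℕ, ∃ c : ℝ, 0 < c ∧ ∃ n₀ : ℕ, ∀ (t : unitInterval) (M N : ℕ), n₀ ≤ M → N ≤ k * M →
      (cornerPercolation t).real (lrCrossing M N) ≤ 1 - c := by
  intro k
  obtain ⟨c, hc, n₀, h⟩ := hLB (k + 2)
  refine ⟨c, hc, n₀ + k + 2, fun t M N hM hN => ?_⟩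
  obtain ⟨m, rfl⟩ : ∃ m, M = m + 1 := ⟨M - 1, by omega⟩
  have hm : n₀ ≤ m := by omega
  have hNm : N + 1 ≤ (k + 2) * m := by
    have h1 : k * (m + 1) = k * m + k := by ring
    have h2 : (k + 2) * m = k * m + 2 * m := by ring
    omega
  have hlb : c ≤ (cornerPercolation t).real (lrCrossing (N + 1) m) := h t (N + 1) m hm hNm
  have hadd := cornerPercolation_real_lrCrossing_add t m N
  linarith

end Summit.CriticalPhenomena.CardyFormulaZ2.Cruxes.UniformBoxCrossing.NonSlantLine

end
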